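import Literature.AlgebraicGeometry.HodgeTheory.ComplexGysinOrientation
import Literature.AlgebraicGeometry.HodgeTheory.MotivatedClasses
import HarnessLib

/-!
# The action `γ_* : Hᵃ(X(ℂ); ℂ) → Hᵇ(W(ℂ); ℂ)`, `c ↦ pr_{W*}(pr_X^* c ∪ γ)`, of a class
# `γ ∈ H^{2e}((W ⊗ X)(ℂ); ℂ)`, through the Gysin morphisms `complexGysin μ` of an orientation family

Family `hodge`, layer `Literature/AlgebraicGeometry/HodgeTheory`. Part of definition request
`defn-IsMuStableBetti` (route `HodgeConjecture/NikulinTwinTransport`, crux `NikulinSerreCarrier`):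
the route's items `TwinSimilitudeAlgebraic`, `HodgeIsometryAlgebraic`, `HodgeSimilitudeAlgebraic`,
`RealMultiplicationSqrtTwoAlgebraic` and the crux file `Cruxes/NikulinSerreCarrier/TypedCruxAlg.lean`
all spell INLINE the map
`y ↦ complexGysin μ _ _ (fst S S') _ (cupProduct _ (complexBetti.map (snd S S') _ y) γ)`,
"`ψ = fst_*(snd^*(–) ∪ γ)` for an algebraic class `γ` of codimension `2` on `S × S'`"; this file names
it, in all degrees, and proves the three facts those statements lean on.

Sources, verbatim. C. Voisin, *Hodge Theory and Complex Algebraic Geometry II* (2003), proof of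
Thm. 10.17, (10.7): "`α_r^*(β) = pr_{1*}(pr_2^*(β) ∪ α)`"; W. Fulton, *Young Tableaux* (1997),
App. B §B.1 (5): "`f_* : HⁱX = H_{2n-i}X → H_{2n-i}Y = H^{2m-2n+i}Y`" (the Gysin morphism
`PD⁻¹ ∘ f_* ∘ PD` of closed oriented manifolds); Y. André, *Pour une théorie inconditionnelle des
motifs* (1996), §2.1 (p. 14): an operator `H^*(X) → H^*(W)` "donnée par une correspondance
algébrique".

## Content

* `corrAction μ hW hX hab : H^{2e}((W ⊗ X)(ℂ); ℂ) →ₗ Hᵃ(X(ℂ); ℂ) →ₗ Hᵇ(W(ℂ); ℂ)` (`dim W = m`,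
  `dim X = n`, `a + 2e = b + 2n`; the FIRST factor receives, as in `GysinFormalism.corrClass` and
  `corrClassAction`): `corrAction μ hW hX hab γ c = pr_{W*}(pr_X^* c ∪ γ)` with
  `pr_{W*} = complexGysin μ (tensor_holds hW hX) hW (fst W X)` — REAL definition, linear in `γ` and
  in `c`; `corrAction_apply` (`rfl`, literally the route items' inline term when `m = n = 2`,
  `a = b = 2·1`, `e = 2`).
* `corrAction_eq_corrClassAction`: in degrees `b + q = 2m` it is the tree's `corrClassAction`
  (`MotivatedClasses`: the same formula with the topological `gysinMap` of the orientations
  `μ_{W ⊗ X}`, `μ_W`), by `complexGysin_eq_gysinMap`.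
* `isAlgebraicCorrespondence_corrAction`: for `γ ∈ algebraicClasses (W ⊗ X) e` and `μ` with Poincaré
  duality, `corrAction μ hW hX hab γ` is induced by an algebraic correspondence
  (`IsAlgebraicCorrespondence m n W X`, André §2.1).
* `corrAction_eq_smul_of_orientationFamily`: for two orientation families with Poincaré duality,
  `corrAction μ' … = c • corrAction μ …` with `c ≠ 0` (`complexGysin_eq_smul_of_orientationFamily`) —
  the sense in which statements "`corrAction μ … γ = m • Ψ`, `m ≠ 0`, for every `μ`" are
  orientation-free.

Not here: that `corrAction` of an algebraic class maps rational classes to rational classes (up to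
the orientation scalar; `ComplexGysinRational`) and Hodge classes to Hodge classes
(`CorrespondenceActionHodgeClassesOfGysin`, `ComplexGysinHodgeType`) — these are stated for the
hypothesis-structure / topological spellings in those files and are threaded by their consumers.

## References

* [VoisinHodgeII2003] C. Voisin, Hodge Theory and Complex Algebraic Geometry II (2003), proof of
  Thm. 10.17, (10.7).
* [FultonYoungTableaux1997] W. Fulton, Young Tableaux (1997), App. B §B.1 (5)–(6).
* [Andre1996Motifs] Y. André, Pour une théorie inconditionnelle des motifs, Publ. IHÉS 83 (1996), §2.1.
-/

noncomputable section

open CategoryTheory AlgebraicGeometry MonoidalCategory CartesianMonoidalCategory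
open Literature.AlgebraicTopology.SingularHomology

namespace Literature.AlgebraicGeometry.HodgeTheory

section HodgeTheory

variable (μ : OrientationFamily) {m n : ℕ} {W X : Motives.SchemeOver ℂ}

/-- `(a + 2e) + 2m = b + 2(m + n)` from `a + 2e = b + 2n`: the degree equation of
`pr_{W*} : H^{a+2e}((W ⊗ X)(ℂ)) → Hᵇ(W(ℂ))`, `dim (W ⊗ X) = m + n`. [folklore] -/
theorem corrAction_degree {e a b : ℕ} (m : ℕ) (hab : a + 2 * e = b + 2 * n) :
    a + 2 * e + 2 * m = b + 2 * (m + n) := by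
  omega

/-- **The action `γ_* : Hᵃ(X(ℂ); ℂ) → Hᵇ(W(ℂ); ℂ)` of a class `γ ∈ H^{2e}((W ⊗ X)(ℂ); ℂ)` as a
correspondence, through the Gysin morphisms of the orientation family `μ`**:
`γ_*(c) = pr_{W*}(pr_X^* c ∪ γ)`, `a + 2e = b + 2 dim X` ("`α_r^*(β) = pr_{1*}(pr_2^*(β) ∪ α)`"; the
FIRST factor receives), with `pr_{W*} = complexGysin μ … (fst W X)` (Fulton (5), `PD⁻¹ ∘ pr_{W}(ℂ)_* ∘ PD`
in degrees `≤ 2 dim(W ⊗ X)` and `0` above) and the tree's pull-back `complexBetti.map (snd W X)` and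
cup product; linear in `γ` and in `c`. This is `GysinFormalism.corrClass` / `corrClassAction` with the
hypothesis-structure, resp. topological, Gysin map replaced by `complexGysin μ`
(`corrAction_eq_corrClassAction`). [cite: VoisinHodgeII2003, proof of Thm. 10.17 (10.7)]
[cite: FultonYoungTableaux1997, Appendix B §B.1 (5)] -/
def corrAction (hW : Motives.IsSmoothProjective m W) (hX : Motives.IsSmoothProjective n X)
    {e a b : ℕ} (hab : a + 2 * e = b + 2 * n) :
    complexBetti (W ⊗ X) (2 * e) →ₗ[ℂ] complexBetti X a →ₗ[ℂ] complexBetti W b :=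
  (LinearMap.llcomp ℂ (complexBetti X a) (complexBetti (W ⊗ X) (a + 2 * e)) (complexBetti W b)
      (complexGysin μ (Motives.IsSmoothProjective.tensor_holds hW hX) hW (fst W X)
        (corrAction_degree m hab))) ∘ₗ
    (LinearMap.lcomp ℂ (complexBetti (W ⊗ X) (a + 2 * e)) (complexBetti.map (snd W X) a).hom) ∘ₗ
    (cupProduct (rfl : a + 2 * e = a + 2 * e)).flip

/-- Unfolding of `corrAction`: `γ_*(c) = pr_{W*}(pr_X^* c ∪ γ)` with
`pr_{W*} = complexGysin μ (tensor_holds hW hX) hW (fst W X)` — for `m = n = 2`, `a = b = 2·1`,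
`e = 2` literally the term `fst_*(snd^* c ∪ γ)` written inline by the route items of
`HodgeConjecture/NikulinTwinTransport`. [cite: VoisinHodgeII2003, proof of Thm. 10.17 (10.7)] -/
theorem corrAction_apply (hW : Motives.IsSmoothProjective m W) (hX : Motives.IsSmoothProjective n X)
    {e a b : ℕ} (hab : a + 2 * e = b + 2 * n) (γ : complexBetti (W ⊗ X) (2 * e))
    (c : complexBetti X a) :
    corrAction μ hW hX hab γ c =
      complexGysin μ (Motives.IsSmoothProjective.tensor_holds hW hX) hW (fst W X)
        (corrAction_degree m hab)
        (cupProduct (rfl : a + 2 * e = a + 2 * e) (complexBetti.map (snd W X) a c) γ) :=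
  rfl

/-- **`corrAction` is `corrClassAction` for the orientations `μ_{W ⊗ X}`, `μ_W`** in degrees
`b + q = 2 dim W` (where `complexGysin μ` is the topological Gysin homomorphism
`gysinMap (μ _) (μ _) pr_W(ℂ)` through `H_q`, `complexGysin_eq_gysinMap`).
[cite: FultonYoungTableaux1997, Appendix B §B.1 (5)] [cite: VoisinHodgeII2003, proof of Thm. 10.17 (10.7)] -/
theorem corrAction_eq_corrClassAction (hW : Motives.IsSmoothProjective m W)
    (hX : Motives.IsSmoothProjective n X) {e a b q : ℕ} (hab : a + 2 * e = b + 2 * n)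
    (hq : b + q = 2 * m) :
    corrAction μ hW hX hab =
      corrClassAction (μ (Motives.IsSmoothProjective.tensor_holds hW hX)) (μ hW) hab hq := by
  refine LinearMap.ext fun γ ↦ LinearMap.ext fun c ↦ ?_
  rw [corrAction_apply, corrClassAction_apply,
    complexGysin_eq_gysinMap _ _ _ _ (show a + 2 * e + q = 2 * (m + n) by omega) hq]

/-- **`γ_*` is induced by an algebraic correspondence** when `γ` is an algebraic class: for `μ` with
Poincaré duality and `γ ∈ algebraicClasses (W ⊗ X) e = Nᵉ H^{2e}((W ⊗ X)(ℂ); ℂ)`,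
`corrAction μ hW hX hab γ : Hᵃ(X(ℂ)) → Hᵇ(W(ℂ))` satisfies `IsAlgebraicCorrespondence m n W X`
("donnée par une correspondance algébrique"). [cite: Andre1996Motifs, §2.1 remark following Déf. 1 (p. 14)]
[cite: VoisinHodgeII2003, proof of Thm. 10.17 (10.7)] -/
theorem isAlgebraicCorrespondence_corrAction (hμ : μ.HasPoincareDuality)
    (hW : Motives.IsSmoothProjective m W) (hX : Motives.IsSmoothProjective n X) {e a b q : ℕ}
    (hab : a + 2 * e = b + 2 * n) (hq : b + q = 2 * m) {γ : complexBetti (W ⊗ X) (2 * e)}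
    (hγ : γ ∈ algebraicClasses (W ⊗ X) e) :
    IsAlgebraicCorrespondence m n W X (corrAction μ hW hX hab γ) :=
  ⟨μ (Motives.IsSmoothProjective.tensor_holds hW hX), μ hW, hμ _, hμ _, e, q, hab, hq, γ, hγ,
    by rw [corrAction_eq_corrClassAction μ hW hX hab hq]⟩

/-- **`corrAction` depends on the orientation family only up to a non-zero scalar**: for two
orientation families with Poincaré duality, `corrAction μ' hW hX hab = c • corrAction μ hW hX hab`
with `c ≠ 0` (`complexGysin_eq_smul_of_orientationFamily` for `pr_W`). Hence an identity
"`corrAction μ hW hX hab γ = m • Ψ` with `m ≠ 0`" holds for every such `μ` as soon as it holds for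
one. [cite: FultonYoungTableaux1997, Appendix B §B.1 (5)] [cite: HatcherAT2002, §3.3 Thm. 3.26] -/
theorem corrAction_eq_smul_of_orientationFamily {μ μ' : OrientationFamily}
    (hμ : μ.HasPoincareDuality) (hμ' : μ'.HasPoincareDuality) (hW : Motives.IsSmoothProjective m W)
    (hX : Motives.IsSmoothProjective n X) {e a b : ℕ} (hab : a + 2 * e = b + 2 * n) :
    ∃ c : ℂ, c ≠ 0 ∧ corrAction μ' hW hX hab = c • corrAction μ hW hX hab := by
  obtain ⟨c, hc, h⟩ := complexGysin_eq_smul_of_orientationFamily hμ hμ'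
    (Motives.IsSmoothProjective.tensor_holds hW hX) hW (fst W X) (corrAction_degree m hab)
  refine ⟨c, hc, LinearMap.ext fun γ ↦ LinearMap.ext fun x ↦ ?_⟩
  rw [LinearMap.smul_apply, LinearMap.smul_apply, corrAction_apply, corrAction_apply, h,
    LinearMap.smul_apply]

/-- If `γ_* = t • Ψ` with `t ≠ 0` for one orientation family with Poincaré duality, then for any
other one `γ_* = t' • Ψ` with `t' ≠ 0`. [cite: FultonYoungTableaux1997, Appendix B §B.1 (5)] -/
theorem corrAction_eq_smul_iff_of_orientationFamily {μ μ' : OrientationFamily}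
    (hμ : μ.HasPoincareDuality) (hμ' : μ'.HasPoincareDuality) (hW : Motives.IsSmoothProjective m W)
    (hX : Motives.IsSmoothProjective n X) {e a b : ℕ} (hab : a + 2 * e = b + 2 * n)
    (γ : complexBetti (W ⊗ X) (2 * e)) (Ψ : complexBetti X a →ₗ[ℂ] complexBetti W b) :
    (∃ t : ℂ, t ≠ 0 ∧ corrAction μ hW hX hab γ = t • Ψ) ↔
      ∃ t : ℂ, t ≠ 0 ∧ corrAction μ' hW hX hab γ = t • Ψ := by
  constructor
  · rintro ⟨t, ht, h⟩
    obtain ⟨c, hc, hc'⟩ := corrAction_eq_smul_of_orientationFamily hμ hμ' hW hX hab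
    exact ⟨c * t, mul_ne_zero hc ht, by rw [hc', LinearMap.smul_apply, h, smul_smul]⟩
  · rintro ⟨t, ht, h⟩
    obtain ⟨c, hc, hc'⟩ := corrAction_eq_smul_of_orientationFamily hμ' hμ hW hX hab
    exact ⟨c * t, mul_ne_zero hc ht, by rw [hc', LinearMap.smul_apply, h, smul_smul]⟩

end HodgeTheory

end Literature.AlgebraicGeometry.HodgeTheory

end
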